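import Summits.KontsevichZagierPeriods.Zeta5Search.LaiSweepShard

/-!
# `κ₃` sweep certificate — shard file 031 of 127 (shards 217–223 of 889)

HONEST FRAMING. Systematic search; no irrationality claim unless certified. This file only checks,
by `decide +kernel`, shards 217–223 of the order-cell sweep of the `κ₃` point `(74, 2180, 444; δ74)`
(engine `LaiSweepEngine`, soundness `LaiSweepJump/Free/Eval/Shard/Kappa3`; a shard is `⟨regime, n,
p, q, p', q', Lo, Up⟩`: `n` cells from `p/q` to `p'/q'` with integer rate sums in `[Lo, Up]`, `K =
128`, `D = 2^40`). It draws NO conclusion: only the capstone `LaiKappa3SweepCert`, which needs all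
127 shard files, does. Kernel cost of this file ≈ 560 cells × 0.3 s.
-/

namespace Summit.KontsevichZagierPeriods.Zeta5Search.Sweep

set_option maxHeartbeats 100000000 in
/-- Shard 217: 80 cells of regime B from `59/381` to `37/237`.
[cite: Lai2024BallRivoal, §4 Lemma 4.3] -/
theorem shard217 :
    Shard.check 128 (2^40)
      ⟨true, 80, 59, 381, 37, 237, 41986228433026, 42652270973034⟩ = true := by
  decide +kernel

set_option maxHeartbeats 100000000 in
/-- Shard 218: 80 cells of regime B from `37/237` to `189/1201`.
[cite: Lai2024BallRivoal, §4 Lemma 4.3] -/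
theorem shard218 :
    Shard.check 128 (2^40)
      ⟨true, 80, 37, 237, 189, 1201, 41285392468560, 41953404174766⟩ = true := by
  decide +kernel

set_option maxHeartbeats 100000000 in
/-- Shard 219: 80 cells of regime B from `189/1201` to `56/353`.
[cite: Lai2024BallRivoal, §4 Lemma 4.3] -/
theorem shard219 :
    Shard.check 128 (2^40)
      ⟨true, 80, 189, 1201, 56, 353, 41558515822527, 42244685202827⟩ = true := by
  decide +kernel

set_option maxHeartbeats 100000000 in
/-- Shard 220: 80 cells of regime B from `56/353` to `47/294`.
[cite: Lai2024BallRivoal, §4 Lemma 4.3] -/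
theorem shard220 :
    Shard.check 128 (2^40)
      ⟨true, 80, 56, 353, 47, 294, 39765026299127, 40431248793499⟩ = true := by
  decide +kernel

set_option maxHeartbeats 100000000 in
/-- Shard 221: 80 cells of regime B from `47/294` to `34/211`.
[cite: Lai2024BallRivoal, §4 Lemma 4.3] -/
theorem shard221 :
    Shard.check 128 (2^40)
      ⟨true, 80, 47, 294, 34, 211, 40934946785213, 41634399594117⟩ = true := by
  decide +kernel

set_option maxHeartbeats 100000000 in
/-- Shard 222: 80 cells of regime B from `34/211` to `19/117`.
[cite: Lai2024BallRivoal, §4 Lemma 4.3] -/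
theorem shard222 :
    Shard.check 128 (2^40)
      ⟨true, 80, 34, 211, 19, 117, 40192696679180, 40891694047028⟩ = true := by
  decide +kernel

set_option maxHeartbeats 100000000 in
/-- Shard 223: 80 cells of regime B from `19/117` to `9/55`.
[cite: Lai2024BallRivoal, §4 Lemma 4.3] -/
theorem shard223 :
    Shard.check 128 (2^40)
      ⟨true, 80, 19, 117, 9, 55, 39347200164423, 40042850079974⟩ = true := by
  decide +kernel

/-- The checked shards of this file, in order. [folklore] -/
def shards031 : List (CheckedShard 128 (2^40)) :=
  [⟨_, shard217⟩, ⟨_, shard218⟩, ⟨_, shard219⟩, ⟨_, shard220⟩, ⟨_, shard221⟩,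
    ⟨_, shard222⟩, ⟨_, shard223⟩]

end Summit.KontsevichZagierPeriods.Zeta5Search.Sweep
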